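import Summits.QuantumFields.Balaban3D.Carriers.Regions
import Summits.QuantumFields.Balaban3D.Proofs.Constants

/-!
# Bałaban CMP 102 (1985), d = 3 lane — `Proofs.StarCountRun3`: the star-count leaf (LEAF-LEDGER C9) ON THE CARRIER SEAT'S REGIONS —
# `Λ_{k+1} = Ω_{k+1}^{(k+1)}` as a finite set of coarse sites, `#(T^{(k)} ∖ B(Λ_{k+1})) ≤ |Z_k|`, and `StarCount P 3`

Source: T. Bałaban, CMP **102** (1985) 255–275 [Balaban1985UV3]: p. 268 = PDF 14 «We change the definition of Λ_k, taking Λ_k =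
Ω_k^{(k)}∖Ω_{k+1}^{(k)}, and we define Λ_{k+1} = Ω_{k+1}^{(k+1)}, hence Ω_{k+1}^{(k)} = B(Λ_{k+1})», «The first is simply the integral
restricted to Z_k = B(Λ_{k+1})ᶜ»; p. 260 (after (18)) the count `|Ω₁*|`; p. 265 L8–9 / p. 271 L13 the complement of the constants
(the UNPRINTED two-sided count `0 ≤ |T₁^{(k)*}| − |B(Λ_{k+1})*| ≤ c₁|Z_k|` = the 4D cell's leaf `B10SectAGathering.StarCount`).  Lane
`pub-balaban3d`, seat p3 (row C9; regions = carrier seat p1's `Carriers.Regions`: `Omega`, `Zreg`, `ZVol`, `coarsen`).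

WHAT THIS FILE PROVES (kernel; standard axioms; no definitions — `LamFin` = print's Λ_{k+1} now lives in p1's `Carriers.Regions`):
* (uses p1's `Carriers.coarsen_surjective`: every site of `T^{(j)}` is the `j`-fold block of some fine site, `j ≤ m + K`.)
* (uses p1's `Carriers.LamFin M₁ Rcol k h` — «Λ_{k+1} = Ω_{k+1}^{(k+1)}»: the sites `y` of `T^{(k+1)}` whose block carries a fine site of
  `Ω_{k+1}(h)`, p1's `Omega … (k+1) h (k+1) ⊂ T_η`, a union of big blocks; Regions v1.1 took the definition over from this file's v1.)
* `card_compl_blockSet_lamFin_le_zvol` — **`#(T^{(k)} ∖ B(Λ_{k+1}(h))) ≤ |Z_k(h)|`** with p1's `ZVol … (k+1) h k` (= the number of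
  unit-lattice sites whose block meets `Z_k(h) = Ω_{k+1}(h)ᶜ`): a site `z ∉ B(Λ_{k+1})` has a fine site `x` over it (surjectivity),
  `x ∉ Ω_{k+1}(h)` (else `blockOf z ∈ Λ_{k+1}`), so `z` is counted by `|Z_k|`.
* **`starCount_leaf_run3`** — for step pieces over ANY tower whose histories at level `k + 1` are p1's `Carriers.Hist S.P (k+1)` and whose
  `starT`, `starB h`, `Zvol h` are `starCount univ`, `starCount (LamFin … k h)`, `ZVol … (k+1) h k`: `B10SectAGathering.StarCount P 3`
  (`Constants.starCount_leaf_three_of_le`).  This is row C9 for the carrier seat's `pieces3` as soon as it books `starB`/`Zvol` this way.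
HONEST FRAMING (PLAN §0): pure lattice combinatorics on the constructed regions; nothing of the paper's analysis is asserted.
-/

namespace Summit.QuantumFields.Balaban3D.Proofs.StarCountRun3

open Literature.MathematicalPhysics.QuantumFieldTheory.Balaban1983to89
open Literature.MathematicalPhysics.QuantumFieldTheory.Balaban1983to89.B10
open Summit.QuantumFields.Balaban3D.Carriers
open Summit.QuantumFields.Balaban3D.Proofs.Constants

variable {P : Params}

/-! ## §1 The complement count for `Λ_{k+1} = Ω_{k+1}^{(k+1)}` (p1's `Carriers.LamFin`) -/

section Regions

variable (M₁ : ℕ) (Rcol : ℕ → ℕ)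

/-- **`#(T^{(k)} ∖ B(Λ_{k+1}(h))) ≤ |Z_k(h)|`**: the unit-lattice sites outside `B(Λ_{k+1})` (`B10StarCount.blockSet`) are among the sites
whose block meets `Z_k(h) = Ω_{k+1}(h)ᶜ` (p1's `ZVol … (k+1) h k`), for `k + 1 ≤ m + K`. [cite: Balaban1985UV3, p.266 L12–13 + p.268] -/
theorem card_compl_blockSet_lamFin_le_zvol {k : ℕ} (hk : k + 1 ≤ P.m + P.K) (h : Hist P (k + 1)) :
    ((B10StarCount.blockSet (LamFin M₁ Rcol k h))ᶜ.card : ℝ) ≤ (ZVol M₁ Rcol (k + 1) h k : ℝ) := by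
  classical
  have hsub : (B10StarCount.blockSet (LamFin M₁ Rcol k h))ᶜ ⊆
      Finset.univ.filter (fun z : Site P k => ∃ x : Site P 0, coarsen k x = z ∧ x ∈ Zreg M₁ Rcol h k) := by
    intro z hz
    rw [Finset.mem_compl, B10StarCount.mem_blockSet] at hz
    obtain ⟨x, hx⟩ := coarsen_surjective k (by omega) z
    refine Finset.mem_filter.mpr ⟨Finset.mem_univ _, x, hx, ?_⟩
    -- x ∉ Ω_{k+1}(h), else blockOf z = coarsen (k+1) x ∈ Λ_{k+1}
    intro hxΩ
    apply hz
    rw [mem_lamFin]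
    exact ⟨x, by show blockOf (coarsen k x) = blockOf z; rw [hx], hxΩ⟩
  have hcard := Finset.card_le_card hsub
  unfold ZVol
  exact_mod_cast hcard

end Regions

/-! ## §2 Row C9 for pieces booked on these regions -/

/-- **THE STAR-COUNT LEAF ON THE CARRIER SEAT'S REGIONS** (LEAF-LEDGER C9, `c₁ = 3`): on a d = 3 torus tower `P` (for a lattice
approximation `S`: `P := S.P`, `hd := rfl`) and step pieces over ANY tower whose level-`(k+1)` histories are `Carriers.Hist P (k+1)` and which book `starT := starCount univ` (the whole
unit lattice `T^{(k)}`), `starB h := starCount (Λ_{k+1}(h))` (`LamFin`), `Zvol h := |Z_k(h)|` (p1's `ZVol … (k+1) h k`), the leaf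
`B10SectAGathering.StarCount P 3` holds: `0 ≤ |T₁^{(k)*}| − |B(Λ_{k+1})*| ≤ 3|Z_k|`. [cite: Balaban1985UV3, p.265 L8–9 + p.271 L13] -/
theorem starCount_leaf_run3 {P : Params} (hd : P.d = 3) (M₁ : ℕ) (Rcol : ℕ → ℕ) {T : TowerRun} {k : ℕ}
    (hk : k + 1 ≤ P.m + P.K) (hH : T.Hist (k + 1) = Hist P (k + 1))
    (Pc : B10SectAGathering.StepPieces T k)
    (hT : Pc.starT = (B10StarCount.starCount (Finset.univ : Finset (Site P (k + 1))) : ℝ))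
    (hB : ∀ h, Pc.starB h = (B10StarCount.starCount (LamFin M₁ Rcol k (hH ▸ h)) : ℝ))
    (hZ : ∀ h, (ZVol M₁ Rcol (k + 1) (hH ▸ h) k : ℝ) ≤ Pc.Zvol h) :
    B10SectAGathering.StarCount Pc 3 :=
  starCount_leaf_three_of_le hd hk Pc (fun h => LamFin M₁ Rcol k (hH ▸ h)) hT hB
    (fun h => (card_compl_blockSet_lamFin_le_zvol M₁ Rcol hk (hH ▸ h)).trans (hZ h))

end Summit.QuantumFields.Balaban3D.Proofs.StarCountRun3
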